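import Summits.QuantumFields.BalabanUV.T4Continuum.Support.NE7K1LinBlochSymbolSeam
import Summits.QuantumFields.BalabanUV.T4Continuum.Support.NE7K1LinBlochDenominatorFat

/-!
# NE7K1LinBlochSymbolFold — row NE7 (node U5), candidate route HOM, path H1L, cell K1-lin(s): NEEDS-ESTIMATE #E1, B-E1 TYPED —
# THE FOLDED BLOCK-MEAN MULTIPLIER `k_L ∘ fold`: a MANIFESTLY `2π`-PERIODIC version of `k_L` (real parts folded into `[−π, π)`),
# equal to `k_L` on the closed zone, bounded by `B_F(d)` and HOLOMORPHIC on the whole periodised strip `|Im p_ν| < κ_F(d)` — the safe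
# object for a consumer that meets the multiplier at alias-shifted momenta `p + 2πk` (R-E1), every `L ≥ 1`

Lineage `b2b-balaban-t4-ne7-p2` (CRUX PROVER NE7 #2), generation 74; file 55.  The typed quotient `kL = Δ^ξ_L ∕ 𝓝_L` (file 47) is the
true multiplier on the fat region but takes junk values at the `2π`-translates of the complex zeros of `Δ^ξ_L` (there an alias
denominator vanishes: the true `𝓝_L` has a pole, the true `k_L` a zero).  b04's engine evaluates its symbol at alias-shifted momenta
`p + 2πk`, `k ∈ (ℤ∕n)^D`; for `σ = k_L` this must go through a periodic object.  THIS FILE builds it ([folklore]):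

* §1 `foldR x = toIcoMod 2π (−π) x ∈ [−π, π)`, `foldC`, `foldV` (coordinatewise, imaginary parts untouched), **`kLfold L p := kL L (foldV p)`**;
  `foldR_add_two_pi`, **`kLfold_add_two_pi`** (exact `2π`-periodicity in every coordinate), `foldV_mem_fstrip`,
  **`norm_kLfold_le`** (`‖kLfold‖ ≤ 16d ∕ c_F(d)` whenever all `|Im p_ν| ≤ κ_F(d)` — ALL real parts).
* §2 SEAM INVARIANCE `kL_seamShift`: shifting any set of coordinates of a point `q₀` (all `|Im| ≤ κ`) by `∓2π`, each shifted coordinate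
  having its real part within `1∕4` of `±π`, does not change `k_L` (file 54's `kL_tr_near_face ∕ kL_sub_two_pi_near_face`, one
  coordinate at a time); hence **`kLfold_eq_kL`** on the CLOSED zone `Re p_ν ∈ [−π, π]`, `|Im p_ν| ≤ κ`.
* §3 **`differentiableAt_kLfold`**: `kLfold L` is holomorphic (jointly) at every `p ∈ ℂ^d` with all `|Im p_ν| < κ_F(d)` — near `p`,
  `kLfold = kL ∘ (· − 2πm)` for the integer vector `m` folding `p` (off the seams `fold` is that translation; across a seam the two
  representatives give the same value by §2), and `kL` is holomorphic at `foldV p` (file 50, fattened strip).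

HONEST FRAMING: [folklore]; bookkeeping over files 48 ∕ 50 ∕ 54 and Mathlib's `toIcoMod`; the folded multiplier is NOT `B4ContourShift.StripRegular`
-packaged here (on the strip it coincides with `kL`, file 48's instance); R-E1 untouched; the identification with the finite-torus symbol
NOT typed; nothing of Bałaban's asserted; no `sorry`.  Census only; NE7 NOT PRINTED ∕ NOT PROVED; spine 0∕9; FIXED FINITE T⁴, rung (B)+1;
NOT infinite volume, NOT mass gap, NOT Clay.  HONEST DEPENDENCY: continuum YM on T⁴ ⇐ BetaPertH ∧ nine spine estimates (0/9 proved);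
BetaPertH ⇐ (D1) ∧ (D4) ∧ CAP+tail; G-an2-4 gates asym, D1 and NE2/3/4.
-/

noncomputable section

open Finset Complex Set

namespace Summit.QuantumFields.BalabanUV.T4Continuum.NE7K1LinBlochSymbolFold

open Literature.MathematicalPhysics.QuantumFieldTheory.Balaban1983to89
open Literature.MathematicalPhysics.QuantumFieldTheory.Balaban1983to89.B4Strip
open Literature.MathematicalPhysics.QuantumFieldTheory.Balaban1983to89.B4StripCauchy
open Literature.MathematicalPhysics.QuantumFieldTheory.Balaban1983to89.B5Strip145Analytic
open NE7K1LinBlochDenominator NE7K1LinBlochSymbol NE7K1LinBlochDenominatorFat NE7K1LinBlochSymbolSeam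

variable {d : ℕ}

/-! ### §1 The fold and the folded multiplier -/

/-- fold a real number into `[−π, π)` modulo `2π`. [folklore] -/
def foldR (x : ℝ) : ℝ := toIcoMod Real.two_pi_pos (-Real.pi) x

/-- fold the real part of a complex number into `[−π, π)`, keeping the imaginary part. [folklore] -/
def foldC (z : ℂ) : ℂ := ((foldR z.re : ℝ) : ℂ) + ((z.im : ℝ) : ℂ) * I

/-- coordinatewise fold. [folklore] -/
def foldV (p : Fin d → ℂ) : Fin d → ℂ := fun μ => foldC (p μ)

/-- THE FOLDED BLOCK-MEAN MULTIPLIER `k_L ∘ fold` (manifestly `2π`-periodic in every coordinate). [folklore] -/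
def kLfold (L : ℕ) [NeZero L] (p : Fin d → ℂ) : ℂ := kL L (foldV p)

/-- `foldR x ∈ [−π, π)`. [folklore] -/
theorem foldR_mem (x : ℝ) : foldR x ∈ Set.Ico (-Real.pi) Real.pi := by
  have h := toIcoMod_mem_Ico Real.two_pi_pos (-Real.pi) x
  have e : -Real.pi + 2 * Real.pi = Real.pi := by ring
  rw [e] at h
  exact h

/-- `foldR` is `2π`-periodic. [folklore] -/
theorem foldR_add_two_pi (x : ℝ) : foldR (x + 2 * Real.pi) = foldR x := by
  unfold foldR; rw [toIcoMod_add_right]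

/-- `foldR x = x − 2πm` for the folding integer `m = toIcoDiv`. [folklore] -/
theorem foldR_eq_sub (x : ℝ) : foldR x = x - (toIcoDiv Real.two_pi_pos (-Real.pi) x : ℝ) * (2 * Real.pi) := by
  have h := self_sub_toIcoMod Real.two_pi_pos (-Real.pi) x
  unfold foldR
  rw [zsmul_eq_mul] at h
  linarith

/-- characterisation: if `x − 2πm ∈ [−π, π)` then `foldR x = x − 2πm`. [folklore] -/
theorem foldR_eq_of_mem {x : ℝ} {m : ℤ} (h : x - (m : ℝ) * (2 * Real.pi) ∈ Set.Ico (-Real.pi) Real.pi) :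
    foldR x = x - (m : ℝ) * (2 * Real.pi) := by
  unfold foldR
  rw [toIcoMod_eq_iff]
  refine ⟨?_, m, ?_⟩
  · have e : -Real.pi + 2 * Real.pi = Real.pi := by ring
    rw [e]; exact h
  · rw [zsmul_eq_mul]; ring

/-- real and imaginary parts of `foldC`. [folklore] -/
theorem foldC_re (z : ℂ) : (foldC z).re = foldR z.re := by simp [foldC]

/-- real and imaginary parts of `foldC`. [folklore] -/
theorem foldC_im (z : ℂ) : (foldC z).im = z.im := by simp [foldC]

/-- `foldC z = z − 2πm` for the folding integer of `Re z`. [folklore] -/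
theorem foldC_eq_sub (z : ℂ) :
    foldC z = z - (((toIcoDiv Real.two_pi_pos (-Real.pi) z.re : ℝ) * (2 * Real.pi) : ℝ) : ℂ) := by
  apply Complex.ext
  · rw [foldC_re, foldR_eq_sub]; simp
  · rw [foldC_im]; simp

/-- `foldC` is `2π`-periodic. [folklore] -/
theorem foldC_add_two_pi (z : ℂ) : foldC (z + 2 * Real.pi) = foldC z := by
  apply Complex.ext
  · rw [foldC_re, foldC_re]
    have : (z + 2 * (Real.pi : ℂ)).re = z.re + 2 * Real.pi := by simp
    rw [this, foldR_add_two_pi]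
  · rw [foldC_im, foldC_im]; simp

/-- **EXACT `2π`-PERIODICITY OF THE FOLDED MULTIPLIER** in every coordinate, on all of `ℂ^d`. [folklore] -/
theorem kLfold_add_two_pi (L : ℕ) [NeZero L] (p : Fin d → ℂ) (μ : Fin d) :
    kLfold L (Function.update p μ (p μ + 2 * Real.pi)) = kLfold L p := by
  unfold kLfold
  congr 1
  funext ν
  unfold foldV
  by_cases h : ν = μ
  · subst h; rw [Function.update_self, foldC_add_two_pi]
  · rw [Function.update_of_ne h]

/-- in `tr` notation: `kLfold L (tr p μ) = kLfold L p`. [folklore] -/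
theorem kLfold_tr (L : ℕ) [NeZero L] (p : Fin d → ℂ) (μ : Fin d) : kLfold L (tr p μ) = kLfold L p := by
  rw [tr_def]; exact kLfold_add_two_pi L p μ

/-- the folded point lies in the fattened strip of file 50 as soon as all `|Im p_ν| ≤ κ_F(d)` (its real parts are in `[−π, π)`). [folklore] -/
theorem foldV_mem_fstrip {p : Fin d → ℂ} (hp : ∀ ν, |(p ν).im| ≤ kappaF d) :
    foldV p ∈ FStrip d (rOf d / 2) (kappaF d) := by
  intro ν
  have hr := rOf_pos d
  obtain ⟨h1, h2⟩ := foldR_mem ((p ν).re)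
  refine ⟨?_, ?_⟩
  · show |(foldC (p ν)).re| ≤ Real.pi + rOf d / 2
    rw [foldC_re]
    exact abs_le.mpr ⟨by linarith, by linarith⟩
  · show |(foldC (p ν)).im| ≤ kappaF d
    rw [foldC_im]; exact hp ν

/-- **THE FOLDED MULTIPLIER IS BOUNDED ON THE WHOLE PERIODISED STRIP**: `‖kLfold L p‖ ≤ 16d ∕ c_F(d)` whenever all `|Im p_ν| ≤ κ_F(d)` —
for ARBITRARY real parts, every `L ≥ 1`. [folklore] -/
theorem norm_kLfold_le (L : ℕ) [NeZero L] {p : Fin d → ℂ} (hp : ∀ ν, |(p ν).im| ≤ kappaF d) :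
    ‖kLfold L p‖ ≤ 16 * d / cF d :=
  norm_kL_le_fstrip L (foldV_mem_fstrip hp)

/-! ### §2 Seam invariance of `k_L` and agreement on the closed zone -/

/-- the partially shifted point: coordinates in `T` shifted, the others not. [folklore] -/
def seamShift (q₀ : Fin d → ℂ) (ε : Fin d → ℤ) (T : Finset (Fin d)) : Fin d → ℂ :=
  fun ν => if ν ∈ T then q₀ ν + ((ε ν : ℝ) : ℂ) * (2 * Real.pi) else q₀ ν

/-- imaginary parts are untouched by a seam shift. [folklore] -/
theorem seamShift_im (q₀ : Fin d → ℂ) (ε : Fin d → ℤ) (T : Finset (Fin d)) (ν : Fin d) :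
    (seamShift q₀ ε T ν).im = (q₀ ν).im := by
  unfold seamShift
  split_ifs <;> simp

/-- inserting a coordinate into the shifted set updates that coordinate. [folklore] -/
theorem seamShift_insert (q₀ : Fin d → ℂ) (ε : Fin d → ℤ) (T : Finset (Fin d)) (ν : Fin d) (hν : ν ∉ T) :
    seamShift q₀ ε (insert ν T) = Function.update (seamShift q₀ ε T) ν (q₀ ν + ((ε ν : ℝ) : ℂ) * (2 * Real.pi)) := by
  funext μ
  by_cases h : μ = ν
  · subst h
    rw [Function.update_self]
    simp [seamShift]
  · rw [Function.update_of_ne h]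
    simp [seamShift, Finset.mem_insert, h]

/-- **SEAM INVARIANCE**: an ADMISSIBLE seam shift — coordinate `ν` moved by `2π·ε_ν`, `ε_ν ∈ {−1, 0, 1}`, a coordinate moved by `−2π`
(resp. `+2π`) having its real part within `1∕4` of `π` (resp. `−π`) — of any set `T` of coordinates does not change `k_L`, provided all
`|Im q₀_ν| ≤ κ` (`κ ≤ 1`, `dκ² ≤ 1∕16`) — file 54's two seam lemmas, one coordinate at a time. [folklore] -/
theorem kL_seamShift (L : ℕ) [NeZero L] {κ : ℝ} (hκ : κ ≤ 1) (hdκ : (d : ℝ) * κ ^ 2 ≤ 1 / 16)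
    {q₀ : Fin d → ℂ} (hIm : ∀ ν, |(q₀ ν).im| ≤ κ) {ε : Fin d → ℤ}
    (hε : ∀ ν, ε ν = 0 ∨ (ε ν = -1 ∧ Real.pi - 1 / 4 ≤ (q₀ ν).re ∧ (q₀ ν).re ≤ Real.pi + 1 / 4) ∨
      (ε ν = 1 ∧ -Real.pi - 1 / 4 ≤ (q₀ ν).re ∧ (q₀ ν).re ≤ -Real.pi + 1 / 4)) (T : Finset (Fin d)) :
    kL L (seamShift q₀ ε T) = kL L q₀ := by
  classical
  induction T using Finset.induction_on with
  | empty =>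
    have : seamShift q₀ ε ∅ = q₀ := by funext ν; simp [seamShift]
    rw [this]
  | insert ν T hν ih =>
    rw [seamShift_insert q₀ ε T ν hν, ← ih]
    have hImT : ∀ μ, |(seamShift q₀ ε T μ).im| ≤ κ := fun μ => by rw [seamShift_im]; exact hIm μ
    have hνT : seamShift q₀ ε T ν = q₀ ν := by simp [seamShift, hν]
    rcases hε ν with h0 | ⟨h1, hlo, hhi⟩ | ⟨h1, hlo, hhi⟩
    · -- no shift
      rw [h0]; push_cast
      rw [zero_mul, add_zero, ← hνT, Function.update_eq_self]
    · -- shift by −2π near the right face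
      have e : q₀ ν + ((ε ν : ℝ) : ℂ) * (2 * Real.pi) = seamShift q₀ ε T ν - 2 * Real.pi := by
        rw [hνT, h1]; push_cast; ring
      rw [e]
      exact kL_sub_two_pi_near_face L hκ hdκ hImT ν (by rw [hνT]; exact hlo) (by rw [hνT]; exact hhi)
    · -- shift by +2π near the left face
      have e : q₀ ν + ((ε ν : ℝ) : ℂ) * (2 * Real.pi) = seamShift q₀ ε T ν + 2 * Real.pi := by
        rw [hνT, h1]; push_cast; ring
      rw [e, ← tr_def]
      exact kL_tr_near_face L hκ hdκ hImT ν (by rw [hνT]; exact hlo) (by rw [hνT]; exact hhi)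

/-- the full seam shift. [folklore] -/
theorem seamShift_univ (q₀ : Fin d → ℂ) (ε : Fin d → ℤ) :
    seamShift q₀ ε Finset.univ = fun ν => q₀ ν + ((ε ν : ℝ) : ℂ) * (2 * Real.pi) := by
  funext ν; simp [seamShift]

/-- **AGREEMENT ON THE CLOSED ZONE**: for `p` with `Re p_ν ∈ [−π, π]` and `|Im p_ν| ≤ κ` (`κ ≤ 1`, `dκ² ≤ 1∕16`), `kLfold L p = kL L p`
(interior coordinates are not moved; a coordinate on the face `Re = π` is moved by `−2π`, which does not change `k_L`). [folklore] -/
theorem kLfold_eq_kL (L : ℕ) [NeZero L] {κ : ℝ} (hκ : κ ≤ 1) (hdκ : (d : ℝ) * κ ^ 2 ≤ 1 / 16)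
    {p : Fin d → ℂ} (hIm : ∀ ν, |(p ν).im| ≤ κ) (hRe : ∀ ν, -Real.pi ≤ (p ν).re ∧ (p ν).re ≤ Real.pi) :
    kLfold L p = kL L p := by
  classical
  have hπ := Real.pi_pos
  -- the folding integers: 0 inside, 1 on the right face
  set ε : Fin d → ℤ := fun ν => if (p ν).re = Real.pi then -1 else 0 with hεdef
  have hfold : foldV p = seamShift p ε Finset.univ := by
    rw [seamShift_univ]
    funext ν
    show foldC (p ν) = p ν + ((ε ν : ℝ) : ℂ) * (2 * Real.pi)
    obtain ⟨h1, h2⟩ := hRe ν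
    by_cases hface : (p ν).re = Real.pi
    · have hm : (p ν).re - ((1 : ℤ) : ℝ) * (2 * Real.pi) ∈ Set.Ico (-Real.pi) Real.pi := by
        rw [hface]; push_cast; constructor <;> linarith
      have hf := foldR_eq_of_mem hm
      apply Complex.ext
      · rw [foldC_re, hf, hεdef]; simp [hface]; ring
      · rw [foldC_im, hεdef]; simp
    · have hlt : (p ν).re < Real.pi := lt_of_le_of_ne h2 hface
      have hm : (p ν).re - ((0 : ℤ) : ℝ) * (2 * Real.pi) ∈ Set.Ico (-Real.pi) Real.pi := by
        push_cast; rw [zero_mul, sub_zero]; exact ⟨h1, hlt⟩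
      have hf := foldR_eq_of_mem hm
      apply Complex.ext
      · rw [foldC_re, hf, hεdef]; simp [hface]
      · rw [foldC_im, hεdef]; simp [hface]
  have hε : ∀ ν, ε ν = 0 ∨ (ε ν = -1 ∧ Real.pi - 1 / 4 ≤ (p ν).re ∧ (p ν).re ≤ Real.pi + 1 / 4) ∨
      (ε ν = 1 ∧ -Real.pi - 1 / 4 ≤ (p ν).re ∧ (p ν).re ≤ -Real.pi + 1 / 4) := by
    intro ν
    by_cases hface : (p ν).re = Real.pi
    · right; left
      refine ⟨by rw [hεdef]; simp [hface], by rw [hface]; linarith, by rw [hface]; linarith⟩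
    · left; rw [hεdef]; simp [hface]
  unfold kLfold
  rw [hfold]
  exact kL_seamShift L hκ hdκ hIm hε Finset.univ

/-! ### §3 Holomorphy of the folded multiplier on the periodised strip -/

/-- the neighbourhood of `p` on which the fold is resolved: real parts within `1∕4`, imaginary parts below `κ_F(d)`. [folklore] -/
theorem nbhd_mem {p : Fin d → ℂ} (hp : ∀ ν, |(p ν).im| < kappaF d) :
    {q : Fin d → ℂ | ∀ ν, |(q ν).re - (p ν).re| < 1 / 4 ∧ |(q ν).im| < kappaF d} ∈ nhds p := by
  have hopen : IsOpen {q : Fin d → ℂ | ∀ ν, |(q ν).re - (p ν).re| < 1 / 4 ∧ |(q ν).im| < kappaF d} := by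
    rw [show {q : Fin d → ℂ | ∀ ν, |(q ν).re - (p ν).re| < 1 / 4 ∧ |(q ν).im| < kappaF d}
        = ⋂ ν, ({q : Fin d → ℂ | |(q ν).re - (p ν).re| < 1 / 4} ∩ {q | |(q ν).im| < kappaF d}) by
      ext q; simp]
    refine isOpen_iInter_of_finite (fun ν => IsOpen.inter ?_ ?_)
    · exact isOpen_lt (by fun_prop) continuous_const
    · exact isOpen_lt (by fun_prop) continuous_const
  exact hopen.mem_nhds (fun ν => ⟨by simp, hp ν⟩)

/-- ON THAT NEIGHBOURHOOD THE FOLD IS A FIXED TRANSLATION UP TO AN ADMISSIBLE SEAM SHIFT: with `m_ν` the folding integer of `Re p_ν`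
and `τ q = q − 2πm`, for every `q` in the neighbourhood `foldV q = seamShift (τ q) ε univ` for some admissible `ε`. [folklore] -/
theorem foldV_eq_seamShift {p q : Fin d → ℂ} (hq : ∀ ν, |(q ν).re - (p ν).re| < 1 / 4) :
    ∃ ε : Fin d → ℤ, (∀ ν, ε ν = 0 ∨
        (ε ν = -1 ∧ Real.pi - 1 / 4 ≤ ((fun ν => q ν - (((toIcoDiv Real.two_pi_pos (-Real.pi) (p ν).re : ℝ) * (2 * Real.pi) : ℝ) : ℂ)) ν).re ∧
          ((fun ν => q ν - (((toIcoDiv Real.two_pi_pos (-Real.pi) (p ν).re : ℝ) * (2 * Real.pi) : ℝ) : ℂ)) ν).re ≤ Real.pi + 1 / 4) ∨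
        (ε ν = 1 ∧ -Real.pi - 1 / 4 ≤ ((fun ν => q ν - (((toIcoDiv Real.two_pi_pos (-Real.pi) (p ν).re : ℝ) * (2 * Real.pi) : ℝ) : ℂ)) ν).re ∧
          ((fun ν => q ν - (((toIcoDiv Real.two_pi_pos (-Real.pi) (p ν).re : ℝ) * (2 * Real.pi) : ℝ) : ℂ)) ν).re ≤ -Real.pi + 1 / 4)) ∧
      foldV q = seamShift (fun ν => q ν - (((toIcoDiv Real.two_pi_pos (-Real.pi) (p ν).re : ℝ) * (2 * Real.pi) : ℝ) : ℂ)) ε Finset.univ := by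
  classical
  have hπ := Real.pi_gt_three
  -- per coordinate: y = Re q_ν − 2πm_ν lies within 1/4 of [−π, π)
  set m : Fin d → ℤ := fun ν => toIcoDiv Real.two_pi_pos (-Real.pi) (p ν).re with hmdef
  have hy : ∀ ν, -Real.pi - 1 / 4 < (q ν).re - (m ν : ℝ) * (2 * Real.pi) ∧ (q ν).re - (m ν : ℝ) * (2 * Real.pi) < Real.pi + 1 / 4 := by
    intro ν
    have hf := foldR_eq_sub ((p ν).re)
    obtain ⟨h1, h2⟩ := foldR_mem ((p ν).re)
    have hq' := abs_lt.mp (hq ν)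
    rw [hmdef]
    constructor <;> linarith
  -- the seam sign per coordinate
  set ε : Fin d → ℤ := fun ν =>
    if Real.pi ≤ (q ν).re - (m ν : ℝ) * (2 * Real.pi) then -1
    else if (q ν).re - (m ν : ℝ) * (2 * Real.pi) < -Real.pi then 1 else 0 with hεdef
  refine ⟨ε, ?_, ?_⟩
  · intro ν
    obtain ⟨hy1, hy2⟩ := hy ν
    have hre : ((fun ν => q ν - (((m ν : ℝ) * (2 * Real.pi) : ℝ) : ℂ)) ν).re = (q ν).re - (m ν : ℝ) * (2 * Real.pi) := by simp
    rw [hre]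
    by_cases hA : Real.pi ≤ (q ν).re - (m ν : ℝ) * (2 * Real.pi)
    · right; left; exact ⟨by rw [hεdef]; simp [hA], by linarith, by linarith⟩
    · by_cases hB : (q ν).re - (m ν : ℝ) * (2 * Real.pi) < -Real.pi
      · right; right; exact ⟨by rw [hεdef]; simp [hA, hB], by linarith, by linarith⟩
      · left; rw [hεdef]; simp [hA, hB]
  · rw [seamShift_univ]
    funext ν
    obtain ⟨hy1, hy2⟩ := hy ν
    show foldC (q ν) = (q ν - (((m ν : ℝ) * (2 * Real.pi) : ℝ) : ℂ)) + ((ε ν : ℝ) : ℂ) * (2 * Real.pi)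
    by_cases hA : Real.pi ≤ (q ν).re - (m ν : ℝ) * (2 * Real.pi)
    · have hεν : ε ν = -1 := by rw [hεdef]; simp [hA]
      have hm' : (q ν).re - ((m ν + 1 : ℤ) : ℝ) * (2 * Real.pi) ∈ Set.Ico (-Real.pi) Real.pi := by
        push_cast; constructor <;> linarith
      have hf := foldR_eq_of_mem hm'
      apply Complex.ext
      · rw [foldC_re, hf, hεν]; simp; ring
      · rw [foldC_im, hεν]; simp
    · by_cases hB : (q ν).re - (m ν : ℝ) * (2 * Real.pi) < -Real.pi
      · have hεν : ε ν = 1 := by rw [hεdef]; simp [hA, hB]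
        have hm' : (q ν).re - ((m ν - 1 : ℤ) : ℝ) * (2 * Real.pi) ∈ Set.Ico (-Real.pi) Real.pi := by
          push_cast; constructor <;> linarith
        have hf := foldR_eq_of_mem hm'
        apply Complex.ext
        · rw [foldC_re, hf, hεν]; simp; ring
        · rw [foldC_im, hεν]; simp
      · have hεν : ε ν = 0 := by rw [hεdef]; simp [hA, hB]
        rw [not_le] at hA; rw [not_lt] at hB
        have hm' : (q ν).re - ((m ν : ℤ) : ℝ) * (2 * Real.pi) ∈ Set.Ico (-Real.pi) Real.pi := ⟨hB, hA⟩
        have hf := foldR_eq_of_mem hm'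
        apply Complex.ext
        · rw [foldC_re, hf, hεν]; simp
        · rw [foldC_im, hεν]; simp

/-- **THE FOLDED MULTIPLIER IS HOLOMORPHIC ON THE WHOLE PERIODISED STRIP**: `kLfold L` is (jointly) complex-differentiable at every
`p ∈ ℂ^d` with all `|Im p_ν| < κ_F(d)` — for every `L ≥ 1`, with NO condition on the real parts.  (Near `p`, `kLfold = kL ∘ (· − 2πm)`
by §2's seam invariance; `kL` is holomorphic at the folded point, which lies in file 50's fattened strip.) [folklore] -/
theorem differentiableAt_kLfold (L : ℕ) [NeZero L] {p : Fin d → ℂ} (hp : ∀ ν, |(p ν).im| < kappaF d) :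
    DifferentiableAt ℂ (kLfold L) p := by
  have hκ1 : kappaF d ≤ 1 := (kappaF_le_eighth d).trans (by norm_num)
  have hdκ : (d : ℝ) * kappaF d ^ 2 ≤ 1 / 16 := by
    have h1 := kappaF_le d
    have h2 := (kappa_small (kappaN_pos d).le (kappaN_le_rOf d)).2
    have h3 : kappaF d ≤ rOf d := by have := rOf_pos d; linarith
    have h4 : kappaF d ^ 2 ≤ rOf d ^ 2 := pow_le_pow_left₀ (kappaF_pos d).le h3 2
    have h5 := d_mul_rOf_sq_le d
    have hd : (0 : ℝ) ≤ d := Nat.cast_nonneg d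
    nlinarith
  -- the fixed translation
  set c : Fin d → ℂ := fun ν => (((toIcoDiv Real.two_pi_pos (-Real.pi) (p ν).re : ℝ) * (2 * Real.pi) : ℝ) : ℂ) with hcdef
  have hτp : (fun ν => p ν - c ν) = foldV p := by
    funext ν
    show p ν - c ν = foldC (p ν)
    rw [foldC_eq_sub]
  -- eventual equality with `kL ∘ τ`
  have hev : kLfold L =ᶠ[nhds p] fun q => kL L (fun ν => q ν - c ν) := by
    filter_upwards [nbhd_mem hp] with q hq
    obtain ⟨ε, hε, hfold⟩ := foldV_eq_seamShift (p := p) (q := q) (fun ν => (hq ν).1)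
    have hImτ : ∀ ν, |((fun ν => q ν - c ν) ν).im| ≤ kappaF d := by
      intro ν; rw [hcdef]; simp; exact (hq ν).2.le
    show kL L (foldV q) = kL L (fun ν => q ν - c ν)
    rw [hfold]
    exact kL_seamShift L hκ1 hdκ hImτ hε Finset.univ
  refine DifferentiableAt.congr_of_eventuallyEq ?_ hev
  have hτ : DifferentiableAt ℂ (fun q : Fin d → ℂ => fun ν => q ν - c ν) p :=
    differentiableAt_pi.2 (fun ν => (differentiableAt_apply ν p).sub (differentiableAt_const _))
  have hk : DifferentiableAt ℂ (kL L) (fun ν => p ν - c ν) := by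
    rw [hτp]
    exact differentiableAt_kL_fstrip L (foldV_mem_fstrip (fun ν => (hp ν).le))
  exact hk.comp p hτ

/-- hence continuous there. [folklore] -/
theorem continuousAt_kLfold (L : ℕ) [NeZero L] {p : Fin d → ℂ} (hp : ∀ ν, |(p ν).im| < kappaF d) :
    ContinuousAt (kLfold L) p :=
  (differentiableAt_kLfold L hp).continuousAt

end Summit.QuantumFields.BalabanUV.T4Continuum.NE7K1LinBlochSymbolFold

end
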